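import Literature.AlgebraicGeometry.HodgeTheory.UnitaryTypeOneTimesCMCurveProductSpan
import HarnessLib

/-!
# Word combinatorics of `{1} × [U_F(V_Y,ψ), U_F(V_Y,ψ)]` on ONE copy of `H¹(Y) ⊕ H¹(E)`: root-difference weights inside EVEN blocks, `Θ`-balance and one slot force `Y`-kind balance by PARITY (Moonen–Zarhin 1999 §5 (5.12), case (g): «`(-1,1) ∈ Hg(X)` acts on `H¹(X₁) ⊗ H³(X₂)` as `-1`»)

Family `hodge`, layer `Literature/AlgebraicGeometry/HodgeTheory`. Research context: cell `pub-hodge-ring2` (HONEST FRAMING: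
research route conditional on HC_CM; not a corollary; Q11.4-sentence-2 already refuted in dim ≥ 3), Literature lane
(lit gen 65), programme R40 = heir item H2 (Moonen–Zarhin Thm. 0.2 (3), case (g) with `End⁰(X₂) = F ⊋ k` a QUARTIC CM
field), the WORD-COMBINATORIAL CORE of its geometric half — the quartic companion of
`UnitaryTypeOneTimesCMCurveProductSpan.sum_kindSign_inl_eq_zero_of_rootDiffWeights` (R29, `End⁰(Y) = k`, ONE block of
`dim Y` pairs, inequality `#{κ=0} ≥ #{κ=1}+2`). UNCONDITIONAL finite combinatorics; theorems only (no definition, no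
named fact, no `sorry`); no step towards a summit statement.

PRINTED RESULT. B. Moonen, Yu. Zarhin, Math. Ann. 315 (1999), §5 (5.12) (held `paper:arxiv-math_9901113`, chunk p0011
L79–L84): «Finally, suppose we are in case (g). Again we only have to look at `H⁴(X,ℚ)`. The only interesting Künneth
component in this case is `H¹(X₁,ℚ) ⊗ H³(X₂,ℚ)`. As we have shown, `Hg(X) = {(u₁,u₂) ∈ U_k × Hg(Y) ∣ u₁² · det_k(u₂) = 1}`.
In particular we have an element `(-1,1) ∈ Hg(X)` which acts on `H¹(X₁,ℚ) ⊗ H³(X₂,ℚ)` as `-1`. This shows there are no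
Hodge classes in `H¹(X₁,ℚ) ⊗ H³(X₂,ℚ)` and that `B•(X)` is generated by divisor classes.» The element `(-1,1)` lies in
`{1} × [U_F, U_F]` (`-1 ∈ SL₂ × SL₂`); infinitesimally its effect is a PARITY statement on the weights of the diagonal
root-difference elements `E_ii - E_jj` of the blocks `𝔰𝔩(W_{μ₁})`, `𝔰𝔩(W_{μ₂})` of
`[𝔲_F(V_Y,ψ), 𝔲_F(V_Y,ψ)]_ℂ ≅ 𝔰𝔩(W_{μ₁}) × 𝔰𝔩(W_{μ₂})` (the Lie step of the lane's
`Motives/HodgeThetaAnnihilatorQuarticUnitaryTimesCMCurve`): an `𝔰𝔩₂ × 𝔰𝔩₂`-invariant tensor word has an EVEN number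
of `Y`-letters in each block.

THIS FILE (word model of the tree, interface of the R29 core). Places `Fin hY ⊕ Fin h` (pair index on the `Y`-side —
an adapted `ψ_ℂ`-dual basis of `H¹(Y) ⊗ ℂ` comes in pairs (`W`-member, dual member) —, pair index on the `E`-side,
`h ≤ 1`), kinds `κ` of the `Y`-pairs (`κ ℓ` = Hodge kind of the `W`-member of pair `ℓ`), a BLOCK map `β` on the pairs
(pair `ℓ` belongs to the eigenspace `W_{μ_{β ℓ}}`) all of whose fibres have EVEN size (`dim W_{μ₁} = dim W_{μ₂} = 2`),
and a word `t ↦ (P t, η t)` of EVEN length WITHOUT REPEATED LETTERS (`η t` = Hodge kind of the letter; the `W`-sign of a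
letter of pair `ℓ` is `+1` iff `η t = κ ℓ`). MAIN RESULT `sum_kindSign_inl_eq_zero_of_blockRootDiffWeights`: if the word
is `Θ`-balanced and killed by every root-difference weight `E_ii - E_jj` with `i, j` in the SAME block, then its `Y`-kind
weight vanishes. Proof: inside a block the signed contents `c_ℓ` are all equal (root differences); `c_ℓ ≡ #(letters of
pair ℓ) (mod 2)`; so each block carries an even number of letters, hence so does the `Y`-side, hence (even length) the
`E`-side carries `0` or `2` letters — of different kinds (no repeated letters, `h ≤ 1`) —, so the `E`-kind weight is `0`
and `Θ`-balance gives `Y`-kind weight `0`. (For ONE block of even size this re-proves the R29 core without its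
inequality; for a block of odd size — a threefold of type IV(1,1) — the statement is false and nothing is claimed.)

## References
* [MoonenZarhin1999LowDim] B. Moonen, Yu. Zarhin, Math. Ann. 315 (1999), §5 (5.11) Case 2, (5.12) (held
  `paper:arxiv-math_9901113` chunks p0010–p0011). [cite: MoonenZarhin1999LowDim, §5 (5.11) Case 2 and (5.12)]
* [GoodmanWallachGTM255] R. Goodman, N. Wallach, GTM 255 (2009), §4.1.1 (weights of the diagonal torus on tensor words).
  [cite: GoodmanWallachGTM255, §4.1.1]
-/

namespace Literature.AlgebraicGeometry.HodgeTheory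

/-! ### The parity core -/

section Combinatorics

variable {hY h d nB : ℕ}

/-- **The word-combinatorial core, quartic form (parity).** Places `Fin hY ⊕ Fin h` (`h ≤ 1`), kinds `κ` of the
`Y`-pairs, a block map `β : Fin hY → Fin nB` with all fibres of EVEN size, a word `t ↦ (P t, η t)` of EVEN length
without repeated letters. If the word is `Θ`-balanced (`∑_t ±1 = 0`) and killed by every root-difference weight
`E_ii - E_jj` of the blocks (`β i = β j`; `W`-sign `+1` iff `η t = κ ℓ`), then its `Y`-kind weight vanishes —
«`(-1, 1) ∈ {1} × [U_F, U_F] ⊆ Hg(X)` acts on `H¹(X₁) ⊗ H^{odd}(X₂)` as `-1`», read as: each block carries an even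
number of letters. [cite: MoonenZarhin1999LowDim, §5 (5.11) Case 2 and (5.12)] [cite: GoodmanWallachGTM255, §4.1.1] -/
theorem sum_kindSign_inl_eq_zero_of_blockRootDiffWeights (κ : Fin hY → Fin 2) (β : Fin hY → Fin nB)
    (P : Fin d → Fin hY ⊕ Fin h) (η : Fin d → Fin 2) (hinj : Function.Injective fun t => (P t, η t)) (hh : h ≤ 1)
    (hd : Even d) (hβ : ∀ b : Fin nB, Even (Finset.univ.filter fun ℓ => β ℓ = b).card)
    (hΘ : ∑ t, (if η t = 0 then (1 : ℤ) else -1) = 0)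
    (hD : ∀ i j : Fin hY, β i = β j → ∑ t, Sum.elim (fun ℓ => (if η t = κ ℓ then (1 : ℤ) else -1) *
        ((if ℓ = i then (1 : ℤ) else 0) - (if ℓ = j then (1 : ℤ) else 0))) (fun _ => (0 : ℤ)) (P t) = 0) :
    ∑ t, Sum.elim (fun _ => if η t = 0 then (1 : ℤ) else -1) (fun _ => (0 : ℤ)) (P t) = 0 := by
  classical
  -- the signed content `c ℓ` and the letter count `m ℓ` of the pair `ℓ`
  set c : Fin hY → ℤ := fun ℓ => ∑ t, Sum.elim (fun ℓ' => if ℓ' = ℓ then (if η t = κ ℓ' then (1 : ℤ) else -1) else 0)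
    (fun _ => (0 : ℤ)) (P t) with hc
  set m : Fin hY → ℤ := fun ℓ => ∑ t, Sum.elim (fun ℓ' => if ℓ' = ℓ then (1 : ℤ) else 0) (fun _ => (0 : ℤ)) (P t)
    with hm
  -- (1) `c i = c j` inside a block
  have hcc : ∀ i j, β i = β j → c i = c j := by
    intro i j hij
    have h := hD i j hij
    have hsplit : ∀ t, Sum.elim (fun ℓ => (if η t = κ ℓ then (1 : ℤ) else -1) *
        ((if ℓ = i then (1 : ℤ) else 0) - (if ℓ = j then (1 : ℤ) else 0))) (fun _ => (0 : ℤ)) (P t) =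
        Sum.elim (fun ℓ' => if ℓ' = i then (if η t = κ ℓ' then (1 : ℤ) else -1) else 0) (fun _ => (0 : ℤ)) (P t) -
        Sum.elim (fun ℓ' => if ℓ' = j then (if η t = κ ℓ' then (1 : ℤ) else -1) else 0) (fun _ => (0 : ℤ)) (P t) := by
      intro t
      rcases P t with ℓ | e
      · simp only [Sum.elim_inl]
        split_ifs <;> ring
      · simp
    simp only [hsplit, Finset.sum_sub_distrib] at h
    exact sub_eq_zero.1 h
  -- (2) `c ℓ ≡ m ℓ (mod 2)`
  have hpar : ∀ ℓ, (2 : ℤ) ∣ m ℓ - c ℓ := by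
    intro ℓ
    rw [hm, hc]
    simp only
    rw [← Finset.sum_sub_distrib]
    refine Finset.dvd_sum fun t _ => ?_
    rcases P t with ℓ' | e
    · simp only [Sum.elim_inl]
      split_ifs <;> norm_num
    · simp
  -- (3) each block carries an even number of letters
  have hblock : ∀ b : Fin nB, (2 : ℤ) ∣ ∑ ℓ ∈ Finset.univ.filter (fun ℓ => β ℓ = b), m ℓ := by
    intro b
    set B := Finset.univ.filter (fun ℓ => β ℓ = b) with hB
    have hsplit : ∑ ℓ ∈ B, m ℓ = ∑ ℓ ∈ B, (m ℓ - c ℓ) + ∑ ℓ ∈ B, c ℓ := by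
      rw [← Finset.sum_add_distrib]
      exact Finset.sum_congr rfl fun ℓ _ => by ring
    rw [hsplit]
    refine dvd_add (Finset.dvd_sum fun ℓ _ => hpar ℓ) ?_
    rcases B.eq_empty_or_nonempty with hBe | ⟨ℓ₀, hℓ₀⟩
    · rw [hBe, Finset.sum_empty]
      exact dvd_zero 2
    · have hb₀ : β ℓ₀ = b := (Finset.mem_filter.1 hℓ₀).2
      have hconst : ∀ ℓ ∈ B, c ℓ = c ℓ₀ := fun ℓ hℓ => hcc ℓ ℓ₀ ((Finset.mem_filter.1 hℓ).2.trans hb₀.symm)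
      rw [Finset.sum_congr rfl hconst, Finset.sum_const, nsmul_eq_mul]
      obtain ⟨r, hr⟩ := hβ b
      rw [← hB] at hr
      exact Dvd.intro (r * c ℓ₀) (by rw [hr]; push_cast; ring)
  -- (4) the `Y`-side carries an even number of letters
  set NY : ℤ := ∑ t, Sum.elim (fun _ => (1 : ℤ)) (fun _ => (0 : ℤ)) (P t) with hNY
  have hNY_eq : NY = ∑ ℓ, m ℓ := by
    have hpt : ∀ t, Sum.elim (fun _ => (1 : ℤ)) (fun _ => (0 : ℤ)) (P t) =
        ∑ ℓ, Sum.elim (fun ℓ' => if ℓ' = ℓ then (1 : ℤ) else 0) (fun _ => (0 : ℤ)) (P t) := by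
      intro t
      rcases P t with ℓ₀ | e
      · simp only [Sum.elim_inl, Finset.sum_ite_eq, Finset.mem_univ, if_true]
      · simp
    rw [hNY, Finset.sum_congr rfl fun t _ => hpt t, Finset.sum_comm]
  have hNY2 : (2 : ℤ) ∣ NY := by
    rw [hNY_eq, ← Finset.sum_fiberwise Finset.univ β m]
    exact Finset.dvd_sum fun b _ => hblock b
  -- (5) the `E`-side carries `0` or `2` letters, of different kinds: the `E`-kind weight vanishes
  set a0 : ℤ := ((Finset.univ.filter fun t => (∃ e, P t = Sum.inr e) ∧ η t = 0).card : ℤ) with ha0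
  set a1 : ℤ := ((Finset.univ.filter fun t => (∃ e, P t = Sum.inr e) ∧ η t = 1).card : ℤ) with ha1
  have hcount : ∀ r : Fin 2, ((Finset.univ.filter fun t => (∃ e, P t = Sum.inr e) ∧ η t = r).card : ℤ) ≤ 1 := by
    intro r
    have hle : (Finset.univ.filter fun t => (∃ e, P t = Sum.inr e) ∧ η t = r).card ≤
        ((Finset.univ : Finset (Fin h)).map ⟨(Sum.inr : Fin h → Fin hY ⊕ Fin h), Sum.inr_injective⟩).card := by
      refine Finset.card_le_card_of_injOn P (fun t ht => ?_) (fun t ht t' ht' hPP => ?_)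
      · obtain ⟨⟨e, he⟩, -⟩ := (Finset.mem_filter.1 ht).2
        simp [he]
      · have hr := (Finset.mem_filter.1 (Finset.mem_coe.1 ht)).2.2
        have hr' := (Finset.mem_filter.1 (Finset.mem_coe.1 ht')).2.2
        exact hinj (Prod.ext hPP (hr.trans hr'.symm))
    rw [Finset.card_map, Finset.card_univ, Fintype.card_fin] at hle
    omega
  set uE : ℤ := ∑ t, Sum.elim (fun _ => (0 : ℤ)) (fun _ => if η t = 0 then (1 : ℤ) else -1) (P t) with huE
  have huE_eq : uE = a0 - a1 := by
    rw [huE, ha0, ha1, Finset.card_filter, Finset.card_filter, Nat.cast_sum, Nat.cast_sum, ← Finset.sum_sub_distrib]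
    refine Finset.sum_congr rfl fun t _ => ?_
    rcases hP : P t with ℓ | e
    · simp
    · rcases Fin.exists_fin_two.1 ⟨η t, rfl⟩ with h0 | h1
      · simp [h0]
      · simp [h1]
  set NE : ℤ := ∑ t, Sum.elim (fun _ => (0 : ℤ)) (fun _ => (1 : ℤ)) (P t) with hNE
  have hNE_eq : NE = a0 + a1 := by
    rw [hNE, ha0, ha1, Finset.card_filter, Finset.card_filter, Nat.cast_sum, Nat.cast_sum, ← Finset.sum_add_distrib]
    refine Finset.sum_congr rfl fun t _ => ?_
    rcases hP : P t with ℓ | e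
    · simp
    · rcases Fin.exists_fin_two.1 ⟨η t, rfl⟩ with h0 | h1
      · simp [h0]
      · simp [h1]
  have hsumN : NY + NE = d := by
    have e : ∑ t, (Sum.elim (fun _ => (1 : ℤ)) (fun _ => (0 : ℤ)) (P t) +
        Sum.elim (fun _ => (0 : ℤ)) (fun _ => (1 : ℤ)) (P t)) = ∑ _t : Fin d, (1 : ℤ) :=
      Finset.sum_congr rfl fun t _ => by rcases P t with ℓ | e <;> simp
    rw [hNY, hNE, ← Finset.sum_add_distrib, e, Finset.sum_const, Finset.card_univ, Fintype.card_fin, nsmul_eq_mul,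
      mul_one]
  have hNE2 : (2 : ℤ) ∣ NE := by
    obtain ⟨r, hr⟩ := hd
    have hNE' : NE = (d : ℤ) - NY := by rw [← hsumN]; ring
    rw [hNE']
    exact dvd_sub (Dvd.intro r (by rw [hr]; push_cast; ring)) hNY2
  have huE0 : uE = 0 := by
    have h0 := hcount 0
    have h1 := hcount 1
    have h0' : (0 : ℤ) ≤ a0 := Nat.cast_nonneg _
    have h1' : (0 : ℤ) ≤ a1 := Nat.cast_nonneg _
    rw [hNE_eq] at hNE2
    rw [huE_eq]
    rcases hNE2 with ⟨r, hr⟩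
    omega
  -- (6) `Θ`-balance: `Y`-kind weight + `E`-kind weight = 0
  have hsumΘ : ∑ t, Sum.elim (fun _ => if η t = 0 then (1 : ℤ) else -1) (fun _ => (0 : ℤ)) (P t) + uE = 0 := by
    have e : ∑ t, (Sum.elim (fun _ => if η t = 0 then (1 : ℤ) else -1) (fun _ => (0 : ℤ)) (P t) +
        Sum.elim (fun _ => (0 : ℤ)) (fun _ => if η t = 0 then (1 : ℤ) else -1) (P t)) =
        ∑ t, (if η t = 0 then (1 : ℤ) else -1) :=
      Finset.sum_congr rfl fun t _ => by rcases P t with ℓ | e <;> simp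
    rw [huE, ← Finset.sum_add_distrib, e]
    exact hΘ
  rw [huE0, add_zero] at hsumΘ
  exact hsumΘ

/-- **One block of even size** (an abelian variety `Y` of EVEN dimension with `End⁰(Y) = k` imaginary quadratic, ONE
eigenspace `W` of `dim Y` pairs): the R29 core `sum_kindSign_inl_eq_zero_of_rootDiffWeights` without its inequality
`#{κ=0} ≥ #{κ=1}+2`, for words of even length — «`(-1,1)` acts as `-1` on `H¹(X₁) ⊗ H^{odd}(X₂)`».
[cite: MoonenZarhin1999LowDim, §5 (5.11) Case 2 and (5.12)] [cite: GoodmanWallachGTM255, §4.1.1] -/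
theorem sum_kindSign_inl_eq_zero_of_rootDiffWeights_of_even (κ : Fin hY → Fin 2) (P : Fin d → Fin hY ⊕ Fin h)
    (η : Fin d → Fin 2) (hinj : Function.Injective fun t => (P t, η t)) (hh : h ≤ 1) (hd : Even d) (hY2 : Even hY)
    (hΘ : ∑ t, (if η t = 0 then (1 : ℤ) else -1) = 0)
    (hD : ∀ i j : Fin hY, ∑ t, Sum.elim (fun ℓ => (if η t = κ ℓ then (1 : ℤ) else -1) *
        ((if ℓ = i then (1 : ℤ) else 0) - (if ℓ = j then (1 : ℤ) else 0))) (fun _ => (0 : ℤ)) (P t) = 0) :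
    ∑ t, Sum.elim (fun _ => if η t = 0 then (1 : ℤ) else -1) (fun _ => (0 : ℤ)) (P t) = 0 := by
  classical
  refine sum_kindSign_inl_eq_zero_of_blockRootDiffWeights κ (fun _ => (0 : Fin 1)) P η hinj hh hd (fun b => ?_) hΘ
    (fun i j _ => hD i j)
  have : (Finset.univ.filter fun ℓ : Fin hY => (fun _ => (0 : Fin 1)) ℓ = b) = Finset.univ := by
    ext ℓ
    simp [Subsingleton.elim b 0]
  rw [this, Finset.card_univ, Fintype.card_fin]
  exact hY2

end Combinatorics

end Literature.AlgebraicGeometry.HodgeTheory
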